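import Mathlib
import Summits.QuantumFields.BalabanUV.Beta.AnalyticWalkSum216RowNeumann
import Summits.QuantumFields.BalabanUV.Beta.AnalyticWalkSum216RowMonoData
import Summits.QuantumFields.BalabanUV.Beta.UnitLatticeOmegaRowData

/-!
# [Balaban1988RG2Cluster] p. 13 «The operator G̃₃(x) has the same properties as G̃₂, especially it can be expanded into a
# generalized random walk expansion» — ROUTE A.3′ END-TO-END IN ABSTRACT KERNEL FORM: «(T3) as ROW DATA of the decorated
# G̃₂-piece family» + «R_A = the hypotheses of the co-owner's ω-expansion for the sandwiched pieces x·Q̂G_ωQ̂*» ⟹ the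
# Woodbury-recombined family of G₃(x) = (G₂⁻¹ + xQ̂*Q̂)⁻¹ IS x-UNIFORM, VOLUME-FREE ROW DATA, with the (2.16)-shape END
# and the identification at s ≡ 1 (cell topic `Summits/QuantumFields/BalabanUV/Beta`; row-D4 rider (ρ3), BOTH halves joined)

HONEST FRAMING (cell rule).  Discharging `BetaPertH` makes Bałaban's UV stability UNCONDITIONAL — a real constructive-QFT
result; NOT the continuum limit, NOT the Clay problem.  This module discharges NOTHING of `BetaPertH`.  It is [folklore]
bookkeeping: the ONE end-to-end statement of route A.3′ of the row-D4 apex outline (`HOME/b2b-balaban-beta-an4/g37/OUTLINE-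
D4-NODE-A.md` v1.3 §3b–§3d; census `BETA/REMAINDER-BETA.md` §10), composing BY NAME the owner's recombination half
(`AnalyticWalkSum216RowNeumann.rowData_recomb` ∕ `woodbury_termSum'`, volume-free currency `RowData`) with the co-owner
road's U-localisation half (`UnitLatticeOmegaRowData.rowData_decFamilyΩ` ∕ `termSum_decFamilyΩ_one`, unit
`b2b-balaban-beta-d4-p3` gen 4).  After this file and its sibling `AnalyticWalkSum216RowResolventOmega` rider (ρ3) is ONE
kernel theorem (`rowData_resolventΩ` there; `rowData_resolvent` here is its row-data-level core) whose hypotheses are VISIBLY: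
(T3) — a (3.108)∕(2.16)-type localised bound for the pieces of G̃₂'s expansion with the decoration weight `e^{κ₁·#cells}`
(`hG`) —, the instance dictionary R_A — block-locality, near∕far structure, threads∕credits and the two budgets `K₁`, `Φ`
of the unit-lattice pieces `Q̂G_ωQ̂*`, a local-inverse family with an x-UNIFORM budget `C_L` (the co-owner's A2), the
partition and cell geometry —, and the level-`X` smallness `C_L·((2N/M)·XK₁ + XΦ) < 1` (rider (ρ2), R25 «M large
relative to γ₁»).  Nothing of Bałaban's operators is instantiated ((T3) and NODE O.2 untouched); NO class change on any
GAPS row; NOT summit progress.  Unit `b2b-balaban-beta-an4-g38` (owner of `BINDER-OWNERS.md` row D4); `GAPS.md` C-an4-91.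

CITATION HEADER (lean-in-tree rule).  [II] = T. Bałaban, *Renormalization group approach to lattice gauge field theories.
II. Cluster expansions*, Commun. Math. Phys. **116**, 1–22 (1988) [Balaban1988RG2Cluster], p. 13 [PDF 13] (render
`HOME/b2b-balaban-ref1/pages/1988-cmp116-rg-II-cluster/…-p013-x2.png`, READ AS IMAGE by this lineage gens 32–37),
verbatim: *"The resolvent (xI + C*Δ_kC)⁻¹ has a representation similar to (C*Δ_kC)⁻¹. More exactly, the operator
C(xI + C*Δ_kC)⁻¹C* is representated by the integral (3.185) [13] with the additional term −½x‖χ*(QA + D̄μ(QA))‖² under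
the exponential function … The operator G̃₃(x) has the same properties as G̃₂, especially it can be expanded into a
generalized random walk expansion."*; p. 16 [PDF 16] (2.16): *"|R₁(b, b′)| ≦ (O(1)e^{−1∕3δ₀M} + O(α₀ + α₁))
exp(−½δ₀|b₋ − b′₋|)"*.  [13] = T. Bałaban, *Propagators for lattice gauge theories in a background field*, Commun. Math.
Phys. **99**, 389–434 (1985) [Balaban1985BackgroundPropagators], Thm 3.10 p. 416 (3.108) and p. 432 (3.185)–(3.186).
Nothing printed is asserted: the sentences LOCATE the operations; the Woodbury route `(G₂⁻¹ + xQ̂*Q̂)⁻¹ = G₂ −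
x·G₂Q̂*(1 + xQ̂G₂Q̂*)⁻¹Q̂G₂` is the cell's (route A.3′), not the paper's.

WHAT IS CERTIFIED HERE (kernel, sorry-free; [folklore]; ONE index type `Y` carries both lattices, so the sandwich
matrices `P = Q̂*`, `Q = Q̂` are square — a bookkeeping convention, no loss).
§1 SANDWICH closure: `RowData T ρ`, `WRS P c_P`, `WRS Q c_Q` ⟹ `RowData (P·T_w·Q) (c_P(ρc_Q))` (`rowData_const_of_wrs` +
   `prod` + `reindex` BY NAME), `termSum_sandwich`.
§2 THE (T3) SIDE IN CURRENCY: the decorated piece family `ω ↦ (σ ↦ monoAt τ Δ₀ (DG ω) σ • G_ω)` is `RowData` on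
   `‖σ‖ < e^{κ₁}` from the localised bound `Σ_j (Σ_ω e^{κ₁#DG ω}‖G_ω(i,j)‖)e^{κd(i,j)} ≤ ρ_G` ALONE
   (`rowData_decPieces`); at `s ≡ 1` it sums to `Σ_ω G_ω` (`termSum_decPieces_one`).
§3 THE x-SCALED SANDWICHED PIECES `K_ω^{(x)} = x·QG_ωP`: `Ktot = x·Q(ΣG)P`; level-`x` budgets from level-`X` budgets
   (`budgetK₁_scale`, `budgetΦ_scale`); `WRS κ d Rem₂ ≤ C_L((2N/M)K₁ + Φ)` (`wrs_Rem₂_le` — the co-owner's `Rem₂` is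
   majorised by their `stepMajΩSum`; removes the separate `hRem` input of `termSum_decFamilyΩ_one`).
§4 THEOREM A (row-data level): `rowData_resolvent` (x-uniform volume-free row data of the recombined family, constant
   `ρ_G + X·(ρ_G·(c_P(ρ_Ωc_Q))·ρ_G)`), END `wrs_resolvent_sub` (the (2.16)-shape that (T1) consumes), identification
   `woodbury_resolvent` (`= (G(σ)⁻¹ + P(x·1)Q)⁻¹`, the G̃₃(x)-shape); §5 non-vacuity at this level.
THE SIBLING `AnalyticWalkSum216RowResolventOmega` instantiates THEOREM A with the co-owner's `rowData_decFamilyΩ` ∕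
`termSum_decFamilyΩ_one` (THEOREM B: every hypothesis explicit — (T3), R_A, A2, (ρ2) — and jointly satisfiable).
NOT CLAIMED.  Any expansion of Bałaban's G̃₂ (hypothesis `hG` = (T3)); the (3.186) projection layer (Q̃G₃Q̃*)⁻¹ (rider
(ρ1): the same two theorems applied once more after a regrouping of the G₃-family by decoration sets — not done here);
k-uniformity of any constant (NODE O.2); the identification of `σ` with [II]'s `s(Δ)` beyond «one free coordinate at a
time».  NOT summit progress.
PRIOR ART IN THE TREE (searched 2026-08-20): `AnalyticWalkSum216RowData∕RowNeumann∕RowMonoData` (an4 gen 37),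
`UnitLatticeOmega{Terms,Tube,Paths,RowData}` + `UnitLatticeDecoratedRowData` (d4-p3 gen 4) — composed BY NAME, nothing
re-derived; `UnitLatticeResolventWalk.resolventWalkInversion` ∕ `UnitLatticeProjectionWalk.projectionWalkInversion`
(d4-p3: the undecorated x-uniform inversions, riders (ρ1)(ρ2) in letters).
-/

namespace Summit.QuantumFields.BalabanUV.Beta.AnalyticWalkSum216RowResolvent

open Metric Set
open Literature.MathematicalPhysics.QuantumFieldTheory.Balaban1983to89
open B13PerturbativeStep (WRS WeightHyp wrs)
open Summit.QuantumFields.BalabanUV.Beta.AnalyticWalkSum216 (termSum majSum)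
open Summit.QuantumFields.BalabanUV.Beta.AnalyticWalkSum216Algebra (prodTerm prodMaj termSum_reindex)
open Summit.QuantumFields.BalabanUV.Beta.AnalyticWalkSum216Recomb (recombTerm recombMaj)
open Summit.QuantumFields.BalabanUV.Beta.AnalyticWalkSum216RowData (RowData termSum_prod')
open Summit.QuantumFields.BalabanUV.Beta.AnalyticWalkSum216RowNeumann (rowData_recomb woodbury_termSum')
open Summit.QuantumFields.BalabanUV.Beta.AnalyticWalkSum216RowMonoData (rowData_const_of_wrs)
open Summit.QuantumFields.BalabanUV.Beta.UnitLatticeWalkInversion (Hd Pj Ptot)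
open Summit.QuantumFields.BalabanUV.Beta.UnitLatticeDecoratedPaths (credF)
open Summit.QuantumFields.BalabanUV.Beta.UnitLatticeOmegaTerms
open Summit.QuantumFields.BalabanUV.Beta.UnitLatticeOmegaTube (listLen listLen_nonneg decΩ)
open Summit.QuantumFields.BalabanUV.Beta.UnitLatticeOmegaPaths
open Summit.QuantumFields.BalabanUV.Beta.UnitLatticeOmegaRowData

noncomputable section

variable {Y : Type*} [Fintype Y] [DecidableEq Y] {W : Type*} {κ : ℝ} {d : Y → Y → ℝ} {R : ℝ}

/-! ## §1 Sandwich closure of row data by two fixed localised matrices -/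

/-- The SANDWICHED family `w ↦ (σ ↦ P·T_w(σ)·Q)` (in the application `P = Q̂*`, `Q = Q̂`). [folklore] -/
def sandTerm (P Q : Matrix Y Y ℂ) (T : W → ℂ → Matrix Y Y ℂ) : W → ℂ → Matrix Y Y ℂ :=
  fun w σ => P * (T w σ * Q)

/-- Its majorant `Σ_k ‖P(i,k)‖ Σ_l m_w(k,l)‖Q(l,j)‖`. [folklore] -/
def sandMaj (P Q : Matrix Y Y ℂ) (m : W → Y → Y → ℝ) : W → Y → Y → ℝ :=
  fun w i j => ∑ k, ‖P i k‖ * ∑ l, m w k l * ‖Q l j‖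

/-- The re-indexing `W ≃ Unit × (W × Unit)` placing a term between the two one-term constant families. [folklore] -/
def sandIdx (W : Type*) : W ≃ Unit × (W × Unit) where
  toFun w := ((), (w, ()))
  invFun p := p.2.1
  left_inv _ := rfl
  right_inv := fun ⟨(), (_, ())⟩ => rfl

omit [DecidableEq Y] in
/-- `sandTerm` IS the re-indexed product family `const P · (T · const Q)`. [folklore] -/
theorem sandTerm_eq (P Q : Matrix Y Y ℂ) (T : W → ℂ → Matrix Y Y ℂ) :
    sandTerm P Q T = fun w => prodTerm (fun (_ : Unit) (_ : ℂ) => P)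
      (prodTerm T (fun (_ : Unit) (_ : ℂ) => Q)) (sandIdx W w) := rfl

omit [DecidableEq Y] in
/-- `sandMaj` IS the re-indexed product majorant. [folklore] -/
theorem sandMaj_eq (P Q : Matrix Y Y ℂ) (m : W → Y → Y → ℝ) :
    sandMaj P Q m = fun w => prodMaj (fun (_ : Unit) i j => ‖P i j‖)
      (prodMaj m (fun (_ : Unit) i j => ‖Q i j‖)) (sandIdx W w) := rfl

omit [DecidableEq Y] in
/-- **SANDWICH CLOSURE, volume-free**: `RowData T ρ`, `WRS κ d P c_P`, `WRS κ d Q c_Q` ⟹ the sandwiched family is row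
data with majorant `sandMaj` and constant `c_P·(ρ·c_Q)` (`rowData_const_of_wrs` + `RowData.prod` + `reindex` BY NAME).
[folklore] -/
theorem rowData_sandwich {T : W → ℂ → Matrix Y Y ℂ} {m : W → Y → Y → ℝ} {ρ : ℝ} (h : RowData κ d R T m ρ)
    {P Q : Matrix Y Y ℂ} {cP cQ : ℝ} (hP : WRS κ d P cP) (hQ : WRS κ d Q cQ) (hw : WeightHyp κ d) (hR : 0 < R) :
    RowData κ d R (sandTerm P Q T) (sandMaj P Q m) (cP * (ρ * cQ)) := by
  rw [sandTerm_eq, sandMaj_eq]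
  exact ((rowData_const_of_wrs P hP R).prod (h.prod (rowData_const_of_wrs Q hQ R) hw hR) hw hR).reindex (sandIdx W)

omit [Fintype Y] [DecidableEq Y] in
/-- The summed operator of a one-term constant family is the constant. [folklore] -/
theorem termSum_const (K : Matrix Y Y ℂ) (σ : ℂ) : termSum (fun (_ : Unit) (_ : ℂ) => K) σ = K := by
  ext i j
  simp only [termSum]
  rw [tsum_fintype, Fintype.sum_unique]

omit [DecidableEq Y] in
/-- **`termSum (sandTerm P Q T) σ = P·(termSum T σ·Q)`** on the disc (`termSum_prod'` twice). [folklore] -/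
theorem termSum_sandwich {T : W → ℂ → Matrix Y Y ℂ} {m : W → Y → Y → ℝ} {ρ : ℝ} (h : RowData κ d R T m ρ)
    {P Q : Matrix Y Y ℂ} {cP cQ : ℝ} (hP : WRS κ d P cP) (hQ : WRS κ d Q cQ) (hw : WeightHyp κ d) (hR : 0 < R)
    {σ : ℂ} (hσ : σ ∈ ball (0 : ℂ) R) : termSum (sandTerm P Q T) σ = P * (termSum T σ * Q) := by
  have hPc := rowData_const_of_wrs P hP R (κ := κ) (d := d)
  have hQc := rowData_const_of_wrs Q hQ R (κ := κ) (d := d)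
  rw [sandTerm_eq, termSum_reindex, termSum_prod' hPc (h.prod hQc hw hR) hσ, termSum_prod' h hQc hσ,
    termSum_const, termSum_const]

/-! ## §2 The (T3) side in currency: the decorated piece family of G̃₂ -/

section Pieces

variable {Ω : Type*} [Fintype Ω] {Δ : Type*} [DecidableEq Δ]

/-- THE DECORATED PIECE FAMILY of an operator presented as a FINITE sum of localised pieces `G = Σ_ω G_ω` (walk terms
regrouped by localisation domain; `DG ω` = the cells the domain of `G_ω` meets), one decoupling coordinate `s(Δ₀) = σ`
free and the others frozen at `τ`: `ω ↦ (σ ↦ Π_{Δ ∈ DG ω} s(Δ) • G_ω)`. [cite: Balaban1988RG2Cluster, (1.6)–(1.8) p.3] -/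
def decPieces (G : Ω → Matrix Y Y ℂ) (DG : Ω → Finset Δ) (τ : Δ → ℂ) (Δ₀ : Δ) : Ω → ℂ → Matrix Y Y ℂ :=
  fun ω σ => monoAt τ Δ₀ (DG ω) σ • G ω

/-- Its σ-UNIFORM majorant on the disc `‖σ‖ < e^{κ₁}`: `e^{κ₁·#DG ω}·‖G_ω(i,j)‖`. [folklore] -/
def pieceMaj (κ₁ : ℝ) (G : Ω → Matrix Y Y ℂ) (DG : Ω → Finset Δ) : Ω → Y → Y → ℝ :=
  fun ω i j => Real.exp (κ₁ * (DG ω).card) * ‖G ω i j‖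

omit [DecidableEq Y] in
/-- **(T3) IN CURRENCY ⟹ ROW DATA**: the localised bound `Σ_j (Σ_ω e^{κ₁#DG ω}‖G_ω(i,j)‖)·e^{κd(i,j)} ≤ ρ_G` ALONE makes
the decorated piece family row data on `‖σ‖ < e^{κ₁}` with constant `ρ_G`, for EVERY frozen decoration `‖τ(Δ)‖ ≤ e^{κ₁}`
and every free cell `Δ₀` (monomials are entire; `|Π s| ≤ e^{κ₁#DG ω}`; the index is finite).
[cite: Balaban1985BackgroundPropagators, Thm 3.10 (3.108) p.416] -/
theorem rowData_decPieces (G : Ω → Matrix Y Y ℂ) (DG : Ω → Finset Δ) {κ₁ ρG : ℝ}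
    (hG : ∀ i, ∑ j, (∑ ω, pieceMaj κ₁ G DG ω i j) * Real.exp (κ * d i j) ≤ ρG)
    (τ : Δ → ℂ) (hτ : ∀ δ, ‖τ δ‖ ≤ Real.exp κ₁) (Δ₀ : Δ) :
    RowData κ d (Real.exp κ₁) (decPieces G DG τ Δ₀) (pieceMaj κ₁ G DG) ρG where
  ha ω i j := by
    simp only [decPieces, Matrix.smul_apply, smul_eq_mul]
    exact (differentiableOn_monoAt τ Δ₀ _ _).mul (differentiableOn_const _)
  hm ω σ hσ i j := by
    rw [decPieces, Matrix.smul_apply, smul_eq_mul, norm_mul, pieceMaj]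
    refine mul_le_mul_of_nonneg_right ?_ (norm_nonneg _)
    have hσ' : ‖σ‖ ≤ Real.exp κ₁ := (mem_ball_zero_iff.1 hσ).le
    refine (norm_monoAt_le hτ Δ₀ _ hσ').trans (le_of_eq ?_)
    rw [← Real.exp_nat_mul, mul_comm]
  hsum i j := .of_finite
  hρ i := by
    refine le_of_eq_of_le (Finset.sum_congr rfl fun j _ => ?_) (hG i)
    simp only [majSum]
    rw [tsum_fintype]

omit [Fintype Y] [DecidableEq Y] in
/-- At `s ≡ 1` the decorated piece family sums to `Σ_ω G_ω = Ktot G`. [folklore] -/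
theorem termSum_decPieces_one (G : Ω → Matrix Y Y ℂ) (DG : Ω → Finset Δ) (Δ₀ : Δ) :
    termSum (decPieces G DG (fun _ => (1 : ℂ)) Δ₀) 1 = Ktot G := by
  ext i j
  simp only [termSum, decPieces, monoAt_one, one_smul, Ktot]
  rw [tsum_fintype, Matrix.sum_apply]

end Pieces

/-! ## §3 The x-scaled sandwiched unit-lattice pieces, their budgets, and `Rem₂` -/

section PieceK

variable {Ω : Type*}

/-- The unit-lattice pieces of `x·Q̂G₂Q̂*`: `K_ω^{(x)} := x·(Q·G_ω·P)`. [folklore] -/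
def pieceK (Q P : Matrix Y Y ℂ) (G : Ω → Matrix Y Y ℂ) (x : ℂ) : Ω → Matrix Y Y ℂ :=
  fun ω => x • (Q * G ω * P)

omit [DecidableEq Y] in
/-- `Σ_ω K_ω^{(x)} = x·Q·(Σ_ω G_ω)·P`. [folklore] -/
theorem Ktot_pieceK [Fintype Ω] (Q P : Matrix Y Y ℂ) (G : Ω → Matrix Y Y ℂ) (x : ℂ) :
    Ktot (pieceK Q P G x) = x • (Q * Ktot G * P) := by
  simp only [Ktot, pieceK, ← Finset.smul_sum, Finset.mul_sum, Finset.sum_mul]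

omit [DecidableEq Y] in
/-- Entries of the scaled pieces: `‖K_ω^{(x)}(k,l)‖ = ‖x‖·‖(QG_ωP)(k,l)‖`. [folklore] -/
theorem norm_pieceK_apply (Q P : Matrix Y Y ℂ) (G : Ω → Matrix Y Y ℂ) (x : ℂ) (ω : Ω) (k l : Y) :
    ‖pieceK Q P G x ω k l‖ = ‖x‖ * ‖(Q * G ω * P) k l‖ := by
  rw [pieceK, Matrix.smul_apply, smul_eq_mul, norm_mul]

omit [DecidableEq Y] in
/-- Block-locality of the scaled pieces follows from that of `QG_ωP`. [folklore] -/
theorem pieceK_dom {Q P : Matrix Y Y ℂ} {G : Ω → Matrix Y Y ℂ} {Dω : Ω → Finset Y}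
    (hKdom : ∀ ω k l, (Q * G ω * P) k l ≠ 0 → k ∈ Dω ω) (x : ℂ) :
    ∀ ω k l, pieceK Q P G x ω k l ≠ 0 → k ∈ Dω ω := fun ω k l hne => by
  refine hKdom ω k l fun h0 => hne ?_
  rw [pieceK, Matrix.smul_apply, h0, smul_zero]

omit [DecidableEq Y] in
/-- **Level-`x` first-moment budget from the level-`X` one**: `‖x‖ ≤ X` ⟹ the co-owner's `hK₁` for `K^{(x)}` with `X·K₁`.
[folklore] -/
theorem budgetK₁_scale [Fintype Ω] {Q P : Matrix Y Y ℂ} {G : Ω → Matrix Y Y ℂ} {x : ℂ} {X : ℝ} (hx : ‖x‖ ≤ X)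
    (hd : ∀ a b, 0 ≤ d a b) {e : Ω → Y → Y → ℝ} {K₁ : ℝ}
    (hK₁ : ∀ k, ∑ ω, ∑ l, ‖(Q * G ω * P) k l‖ * d k l * Real.exp (e ω k l) ≤ K₁) (k : Y) :
    ∑ ω, ∑ l, ‖pieceK Q P G x ω k l‖ * d k l * Real.exp (e ω k l) ≤ X * K₁ := by
  have hX : 0 ≤ X := (norm_nonneg x).trans hx
  have hS0 : 0 ≤ ∑ ω, ∑ l, ‖(Q * G ω * P) k l‖ * d k l * Real.exp (e ω k l) :=
    Finset.sum_nonneg fun ω _ => Finset.sum_nonneg fun l _ =>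
      mul_nonneg (mul_nonneg (norm_nonneg _) (hd k l)) (Real.exp_pos _).le
  calc ∑ ω, ∑ l, ‖pieceK Q P G x ω k l‖ * d k l * Real.exp (e ω k l)
      = ‖x‖ * ∑ ω, ∑ l, ‖(Q * G ω * P) k l‖ * d k l * Real.exp (e ω k l) := by
        rw [Finset.mul_sum]
        refine Finset.sum_congr rfl fun ω _ => ?_
        rw [Finset.mul_sum]
        exact Finset.sum_congr rfl fun l _ => by rw [norm_pieceK_apply]; ring
    _ ≤ X * ∑ ω, ∑ l, ‖(Q * G ω * P) k l‖ * d k l * Real.exp (e ω k l) := mul_le_mul_of_nonneg_right hx hS0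
    _ ≤ X * K₁ := mul_le_mul_of_nonneg_left (hK₁ k) hX

omit [DecidableEq Y] in
/-- **Level-`x` far-mass budget from the level-`X` one**: the co-owner's `hΦ` for `K^{(x)}` with `X·Φ`. [folklore] -/
theorem budgetΦ_scale [Fintype Ω] {B : Type*} [Fintype B] {Q P : Matrix Y Y ℂ} {G : Ω → Matrix Y Y ℂ} {x : ℂ}
    {X : ℝ} (hx : ‖x‖ ≤ X) {f : Ω → Y → B → ℝ} (hf : ∀ ω l b, 0 ≤ f ω l b) {e : Ω → Y → Y → ℝ} {Φ : ℝ}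
    (hΦ : ∀ k, ∑ ω, ∑ l, (∑ b, f ω l b) * ‖(Q * G ω * P) k l‖ * Real.exp (e ω k l) ≤ Φ) (k : Y) :
    ∑ ω, ∑ l, (∑ b, f ω l b) * ‖pieceK Q P G x ω k l‖ * Real.exp (e ω k l) ≤ X * Φ := by
  have hX : 0 ≤ X := (norm_nonneg x).trans hx
  have hS0 : 0 ≤ ∑ ω, ∑ l, (∑ b, f ω l b) * ‖(Q * G ω * P) k l‖ * Real.exp (e ω k l) :=
    Finset.sum_nonneg fun ω _ => Finset.sum_nonneg fun l _ =>
      mul_nonneg (mul_nonneg (Finset.sum_nonneg fun b _ => hf ω l b) (norm_nonneg _)) (Real.exp_pos _).le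
  calc ∑ ω, ∑ l, (∑ b, f ω l b) * ‖pieceK Q P G x ω k l‖ * Real.exp (e ω k l)
      = ‖x‖ * ∑ ω, ∑ l, (∑ b, f ω l b) * ‖(Q * G ω * P) k l‖ * Real.exp (e ω k l) := by
        rw [Finset.mul_sum]
        refine Finset.sum_congr rfl fun ω _ => ?_
        rw [Finset.mul_sum]
        exact Finset.sum_congr rfl fun l _ => by rw [norm_pieceK_apply]; ring
    _ ≤ X * ∑ ω, ∑ l, (∑ b, f ω l b) * ‖(Q * G ω * P) k l‖ * Real.exp (e ω k l) :=
        mul_le_mul_of_nonneg_right hx hS0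
    _ ≤ X * Φ := mul_le_mul_of_nonneg_left (hΦ k) hX

end PieceK

section RemTwo

variable {B Ω : Type*} [DecidableEq Ω]

/-- The co-owner's step `stepPiece c = pieceA c·(L_bH_b)` is majorised ENTRYWISE by their credited step majorant
`stepMajΩ δ … c` for `δ ≥ 0`, nonnegative `d` and nonnegative credits (the credits only enlarge). [folklore] -/
theorem norm_stepPiece_le {δ : ℝ} (hδ : 0 ≤ δ) (hd : ∀ a b, 0 ≤ d a b) {cr : Ω → ℝ}
    (hcr0 : ∀ ω, 0 ≤ cr ω) (h : B → Y → ℝ) (K : Ω → Matrix Y Y ℂ) (near : B → Finset Ω) (L : B → Matrix Y Y ℂ)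
    (c : B × Ω) (k m : Y) : ‖stepPiece h K near L c k m‖ ≤ stepMajΩ δ d cr h K near L c k m := by
  simp only [stepPiece, stepMajΩ, Matrix.mul_apply]
  refine (norm_sum_le _ _).trans (Finset.sum_le_sum fun l _ => ?_)
  rw [norm_mul, credA, credF]
  have h1 : ‖pieceA h K near c.1 c.2 k l‖ ≤ ‖pieceA h K near c.1 c.2 k l‖ * Real.exp (δ * (d k l + cr c.2)) :=
    le_mul_of_one_le_right (norm_nonneg _) (Real.one_le_exp (mul_nonneg hδ (add_nonneg (hd k l) (hcr0 c.2))))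
  have h2 : ‖(L c.1 * Hd h c.1) l m‖ ≤ ‖(L c.1 * Hd h c.1) l m‖ * Real.exp (δ * d l m) :=
    le_mul_of_one_le_right (norm_nonneg _) (Real.one_le_exp (mul_nonneg hδ (hd l m)))
  exact mul_le_mul h1 h2 (norm_nonneg _) ((norm_nonneg _).trans h1)

/-- **`WRS κ d Rem₂ ≤ C_L·((2N/M)·K₁ + Φ)`**: the co-owner's remainder `Rem₂ = Σ_c stepPiece c` is majorised entrywise by
their `stepMajΩSum`, whose weighted rows `UnitLatticeOmegaPaths.wrs_stepMajΩSum` bounds — so the separate input `hRem` of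
`UnitLatticeOmegaRowData.termSum_decFamilyΩ_one` is the SAME smallness as the row data's. [folklore] -/
theorem wrs_Rem₂_le [Fintype B] [Fintype Ω] (hw : WeightHyp κ d) {δ : ℝ} (hδ : 0 ≤ δ) (cr : Ω → ℝ)
    (hcr0 : ∀ ω, 0 ≤ cr ω) (K : Ω → Matrix Y Y ℂ) (near : B → Finset Ω) (h : B → Y → ℝ) (E : B → Finset Y)
    (L : B → Matrix Y Y ℂ) (hsupp : ∀ b y, y ∉ E b → h b y = 0) (habs : ∀ b y, |h b y| ≤ 1) {M N C_L K₁ Φ : ℝ}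
    (hM : 0 < M) (hLip : ∀ b y y', |h b y - h b y'| ≤ d y y' / M)
    (hN : ∀ y, ((Finset.univ.filter fun b => y ∈ E b).card : ℝ) ≤ N) (hC : 0 ≤ C_L)
    (hL : ∀ b, WRS (κ + δ) d (L b) C_L)
    (hK₁ : ∀ k, ∑ ω, ∑ l, ‖K ω k l‖ * d k l * Real.exp ((κ + δ) * d k l + δ * cr ω) ≤ K₁)
    (hΦ : ∀ k, ∑ ω, ∑ l, (∑ b, if ω ∈ near b then (0 : ℝ) else |h b l|) * ‖K ω k l‖
      * Real.exp ((κ + δ) * d k l + δ * cr ω) ≤ Φ) :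
    WRS κ d (Rem₂ h K near L) (C_L * (2 * N / M * K₁ + Φ)) := by
  have hS := wrs_stepMajΩSum hw cr K near h E L hsupp habs hM hLip hN hC hL hK₁ hΦ
  have hnn : ∀ k m, 0 ≤ stepMajΩSum δ d cr h K near L k m := fun k m => by
    rw [stepMajΩSum, Matrix.sum_apply]
    exact Finset.sum_nonneg fun c _ => stepMajΩ_nonneg δ d cr h K near L c k m
  refine B13PerturbativeStep.WRS.of_majorant (m := fun k m => stepMajΩSum δ d cr h K near L k m)
    (fun k m => ?_) (fun k => ?_)
  · rw [Rem₂, Matrix.sum_apply, stepMajΩSum, Matrix.sum_apply]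
    exact (norm_sum_le _ _).trans (Finset.sum_le_sum fun c _ => norm_stepPiece_le hδ hw.nonneg hcr0 h K near L c k m)
  · have h1 := hS k
    simp only [wrs] at h1
    refine le_of_eq_of_le (Finset.sum_congr rfl fun m _ => ?_) h1
    rw [Real.norm_of_nonneg (hnn k m)]

end RemTwo

/-! ## §4 THEOREM A — the recombined resolvent family at the level of row data -/

section TheoremA

variable {V : Type*} {TG : W → ℂ → Matrix Y Y ℂ} {mG : W → Y → Y → ℝ} {ρG : ℝ}
  {TΩ : V → ℂ → Matrix Y Y ℂ} {mΩ : V → Y → Y → ℝ} {ρΩ : ℝ} {P Q : Matrix Y Y ℂ} {cP cQ : ℝ}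

omit [DecidableEq Y] in
/-- **THEOREM A.**  Row data of the `G`-family (constant `ρ_G`) and of a unit-lattice family (constant `ρ_Ω`), localised
sandwich matrices (`c_P`, `c_Q`), `‖x‖ ≤ X` ⟹ the Woodbury-recombined family `G − x·G·(P·Ω·Q)·G` is row data with the
x-UNIFORM, VOLUME-FREE constant `ρ_G + X·(ρ_G·(c_P(ρ_Ωc_Q))·ρ_G)` (`rowData_recomb` ∘ `rowData_sandwich`).
[cite: Balaban1988RG2Cluster, p.13 after (2.7)] -/
theorem rowData_resolvent [Nonempty Y] (hG : RowData κ d R TG mG ρG) (hΩ : RowData κ d R TΩ mΩ ρΩ)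
    (hP : WRS κ d P cP) (hQ : WRS κ d Q cQ) (hw : WeightHyp κ d) (hR : 0 < R) {x : ℂ} {X : ℝ} (hx : ‖x‖ ≤ X) :
    RowData κ d R (recombTerm TG (sandTerm P Q TΩ) x) (recombMaj mG (sandMaj P Q mΩ) X)
      (ρG + X * (ρG * (cP * (ρΩ * cQ) * ρG))) :=
  rowData_recomb hG (rowData_sandwich hΩ hP hQ hw hR) hw hR hx

omit [DecidableEq Y] in
/-- **END, THEOREM A**: the (2.16)-shape bound for the difference of the recombined family, x-uniform and volume-free —
the input (T1) consumes (`RowData.wrs_termSum_sub` = an4's `wrs_termSum_sub` BY NAME).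
[cite: Balaban1988RG2Cluster, (2.16)–(2.17) p.16] -/
theorem wrs_resolvent_sub [Nonempty Y] (hG : RowData κ d R TG mG ρG) (hΩ : RowData κ d R TΩ mΩ ρΩ)
    (hP : WRS κ d P cP) (hQ : WRS κ d Q cQ) (hw : WeightHyp κ d) (hR : 0 < R) {x : ℂ} {X : ℝ} (hx : ‖x‖ ≤ X)
    {σ : ℂ} (hσ : σ ∈ ball (0 : ℂ) R) :
    WRS κ d (termSum (recombTerm TG (sandTerm P Q TΩ) x) σ - termSum (recombTerm TG (sandTerm P Q TΩ) x) 0)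
      (2 * (ρG + X * (ρG * (cP * (ρΩ * cQ) * ρG))) / R * ‖σ‖) :=
  (rowData_resolvent hG hΩ hP hQ hw hR hx).wrs_termSum_sub hR hσ

/-- **IDENTIFICATION, THEOREM A**: where `G(σ) = termSum TG σ` is invertible, `1 + x·QG(σ)P` is invertible, and the
unit-lattice family sums to `(1 + x·QG(σ)P)⁻¹`, the recombined family sums to `(G(σ)⁻¹ + P(x·1)Q)⁻¹` — the G̃₃(x)-shape
(`woodbury_termSum'` BY NAME). [cite: Balaban1988RG2Cluster, p.13 after (2.7)] -/
theorem woodbury_resolvent [Nonempty Y] (hG : RowData κ d R TG mG ρG) (hΩ : RowData κ d R TΩ mΩ ρΩ)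
    (hP : WRS κ d P cP) (hQ : WRS κ d Q cQ) (hw : WeightHyp κ d) (hR : 0 < R) {x : ℂ} (hx0 : x ≠ 0)
    {σ : ℂ} (hσ : σ ∈ ball (0 : ℂ) R) (hGu : IsUnit (termSum TG σ))
    (hK : IsUnit (1 + x • (Q * termSum TG σ * P))) (hΩsum : termSum TΩ σ = (1 + x • (Q * termSum TG σ * P))⁻¹) :
    ((termSum TG σ)⁻¹ + P * (x • (1 : Matrix Y Y ℂ)) * Q)⁻¹ = termSum (recombTerm TG (sandTerm P Q TΩ) x) σ :=
  woodbury_termSum' hG (rowData_sandwich hΩ hP hQ hw hR) hw hR P Q hx0 hσ hGu hK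
    (by rw [termSum_sandwich hΩ hP hQ hw hR hσ, hΩsum]; simp only [Matrix.mul_assoc])

end TheoremA

/-! ## §5 Non-vacuity at the level of THEOREM A -/

/-- The hypotheses of `rowData_resolvent` ∕ `wrs_resolvent_sub` are jointly satisfiable: one site, the one-term families
`T(σ) = σ` (row data with constant `1` on the unit disc, `AnalyticWalkSum216RowData.rowData_example`), `P = Q = 1`
(`WRS.one`), `x = X = 2`. [folklore] -/
example : WRS (n := Unit) 0 (fun _ _ => 0)
    (termSum (recombTerm (fun (_ : Unit) (σ : ℂ) => fun (_ _ : Unit) => σ)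
        (sandTerm 1 1 (fun (_ : Unit) (σ : ℂ) => fun (_ _ : Unit) => σ)) (2 : ℂ)) (1 / 2) -
      termSum (recombTerm (fun (_ : Unit) (σ : ℂ) => fun (_ _ : Unit) => σ)
        (sandTerm 1 1 (fun (_ : Unit) (σ : ℂ) => fun (_ _ : Unit) => σ)) (2 : ℂ)) 0)
    (2 * (1 + 2 * (1 * (1 * (1 * 1) * 1))) / 1 * ‖(1 / 2 : ℂ)‖) := by
  have hw : WeightHyp (n := Unit) 0 (fun _ _ => 0) := ⟨le_rfl, fun _ => rfl, fun _ _ => le_rfl, fun _ _ _ => by simp⟩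
  have h := AnalyticWalkSum216RowData.rowData_example
  refine wrs_resolvent_sub h h (B13PerturbativeStep.WRS.one hw) (B13PerturbativeStep.WRS.one hw) hw one_pos
    (x := 2) (X := 2) (by simp) ?_
  rw [mem_ball_zero_iff]; norm_num

end

end Summit.QuantumFields.BalabanUV.Beta.AnalyticWalkSum216RowResolvent
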